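import Mathlib
import Summits.ResolutionOfSingularities.ResolutionOfSingularities.Theorems.RadicialJungCleanModelsGenericSpreadFinite
import Summits.ResolutionOfSingularities.ResolutionOfSingularities.Theorems.RadicialJungCleanModelsGenericSpreadScheme
import Literature.AlgebraicGeometry.Resolution.AffineChartFibres
import Literature.AlgebraicGeometry.Resolution.QuasiExcellentSchemes
import HarnessLib

/-!
# Route `RadicialJung`, crux `CleanModels` (stmt-ResolutionOfSingularities-15917), line `Sketch` rev 35, stub 6 `stub_cleanProp44` (X44c),
# work plan O8 / L7b-global, item (G1) on the SCHEME, WITH FINITENESS: clean-regular at the generic point of a one-dimensional regular curve on a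
# quasi-excellent regular scheme ⟹ on an open neighbourhood of the generic point only FINITELY MANY points of the curve fail to be clean-permissible

Memo `Cruxes/CleanModels/Lines/Sketch-memo-hand2-g9-stubs-5-7.md` §3b, residual (b).  Scheme reading of ✓ `exists_not_mem_finite_forall_cleanPermissibleAt_of_cleanRegAt_generic`
(`…GenericSpreadFinite.lean`), exactly as ✓ `exists_isOpen_forall_cleanPermissibleAt_or_deficient_of_cleanRegAt_genericPoint` (p817085) read
✓ p816977: on a regular integral locally Noetherian QUASI-EXCELLENT `X₀` (`char K(X₀) = p`), `C₀ = cl{η}` a regular curve (ideal generated by a regular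
pair at each point, `dim 𝒪_{X₀,η} = 2`) which is ONE-DIMENSIONAL (its points other than `η` are closed in `X₀`), if the line of `G` is clean-regular
at `η` then there is an open `W ∋ η` such that the points `y ∈ W ∩ C₀` at which the line is NOT clean-permissible for `C₀` form a FINITE set.
New plumbing: `Γ(V)/𝔭_η` is J-2 (`Scheme.IsQuasiExcellent`, ✓ `IsJ2Ring.of_finiteType`) and one-dimensional (a prime `𝔮 ⊋ 𝔭` is the prime of a
point `y ∈ V ∩ C₀`, `y ≠ η`, closed by hypothesis, hence maximal — ✓ `primeIdealOf_isMaximal_of_isClosed`); the bad points inject into the finite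
exceptional set of primes by `y ↦ 𝔭_y` (✓ `fromSpec_primeIdealOf`).

Honest framing: OURS (bookkeeping); with (G2) ✓p816363/p816554, (G3) ✓p816341, uniqueness ✓p816640 and L7b ✓p816242 this leaves for L7b-global only
«`C₀ ∖ W` finite» and the output predicate (O6); nothing here proves X44c or any case of `CleanModels`.
-/

noncomputable section

set_option linter.dupNamespace false -- mandated namespace of this single-conjunct summit

open CategoryTheory AlgebraicGeometry TopologicalSpace IsLocalRing Opposite
open Literature.AlgebraicGeometry.Resolution Literature.AlgebraicGeometry.Motives
open Scheme.IdealSheafData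

namespace Summit.ResolutionOfSingularities.ResolutionOfSingularities.Theorems.RadicialJung.CleanModels

/-- **(G1) on the scheme, with finiteness.**  See the module docstring. [cite: CossartPiltant2008, Prop. 4.4 (proof, p. 10)]
[cite: Piltant2013, §2 Axiom 4] [cite: Matsumura1987, §32 p. 260 Definition] -/
theorem exists_isOpen_finite_not_cleanPermissibleAt_of_cleanRegAt_genericPoint {X₀ : Scheme.{0}} [IsIntegral X₀]
    [IsLocallyNoetherian X₀] (hX₀ : Scheme.IsRegular X₀) (hqe : Scheme.IsQuasiExcellent X₀) (p : ℕ) [hp : Fact p.Prime]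
    [CharP X₀.functionField p] {C₀ : Closeds X₀}
    (hC₀reg : ∀ y ∈ (C₀ : Set X₀), ∃ c : Fin 2 → X₀.presheaf.stalk y,
      IsRsopPart c ∧ Ideal.span (Set.range c) = stalkIdeal (vanishingIdeal C₀) y)
    {η : X₀} (hη : (C₀ : Set X₀) = closure {η}) (hdimη : ringKrullDim (X₀.presheaf.stalk η) = 2)
    (hcl : ∀ y ∈ (C₀ : Set X₀), y ≠ η → IsClosed ({y} : Set X₀))
    (G : X₀.functionField) (hGη : CleanRegAt p (RatFn.toFunctionField η) G) :
    ∃ W : X₀.Opens, η ∈ W ∧ {y : X₀ | y ∈ (C₀ : Set X₀) ∧ y ∈ W ∧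
      ¬ CleanPermissibleAt p (RatFn.toFunctionField y) G (stalkIdeal (vanishingIdeal C₀) y)}.Finite := by
  classical
  have hηC : η ∈ (C₀ : Set X₀) := by rw [hη]; exact subset_closure rfl
  have hregC : Scheme.IsRegular (vanishingIdeal C₀).subscheme :=
    isRegular_subscheme_vanishingIdeal_of_forall_isRsopPart fun x hx => by
      obtain ⟨c, hc, h⟩ := hC₀reg x hx
      exact ⟨2, c, hc, h⟩
  obtain ⟨V, hηV, r, q, hgerm⟩ := exists_affineOpen_forall_isRsopPart_germ C₀ hregC (fun x _ => hX₀ x) hηC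
  -- `𝒪_{X₀,η} = Γ(V)_𝔭`
  haveI : Nonempty (V : X₀.Opens) := ⟨⟨η, hηV⟩⟩
  haveI : IsNoetherianRing Γ(X₀, V) := IsLocallyNoetherian.component_noetherian V
  let xη : (V : X₀.Opens) := ⟨η, hηV⟩
  letI algη : Algebra Γ(X₀, V) (X₀.presheaf.stalk η) := TopCat.Presheaf.algebra_section_stalk X₀.presheaf xη
  haveI hlocη : IsLocalization.AtPrime (X₀.presheaf.stalk η) (V.2.primeIdealOf xη).asIdeal := V.2.isLocalization_stalk xη
  haveI : IsFractionRing Γ(X₀, V) X₀.functionField := functionField_isFractionRing_of_isAffineOpen (U := (V : X₀.Opens)) (hU := V.2)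
  haveI : IsScalarTower Γ(X₀, V) (X₀.presheaf.stalk η) X₀.functionField := functionField_isScalarTower X₀ (V : X₀.Opens) xη
  set 𝔭 := (V.2.primeIdealOf xη).asIdeal with h𝔭
  have halgη : ∀ f : Γ(X₀, V), algebraMap Γ(X₀, V) (X₀.presheaf.stalk η) f = (X₀.presheaf.germ V η hηV).hom f := fun f => rfl
  -- `r = 2`
  obtain ⟨hgη, hspanη⟩ := hgerm η hηV hηC
  have hmaxη : stalkIdeal (vanishingIdeal C₀) η = maximalIdeal (X₀.presheaf.stalk η) :=
    stalkIdeal_vanishingIdeal_eq_maximalIdeal_of_closure_eq hη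
  have hr2 : r = 2 := by
    have h1 := hgη.height_span_range
    rw [hspanη, hmaxη] at h1
    have h2 : ((maximalIdeal (X₀.presheaf.stalk η)).height : WithBot ℕ∞) = 2 := by
      rw [IsLocalRing.maximalIdeal_height_eq_ringKrullDim, hdimη]
    rw [h1] at h2
    have h3 : ((r : ℕ∞) : WithBot ℕ∞) = (((2 : ℕ) : ℕ∞) : WithBot ℕ∞) := by rw [h2]; norm_cast
    exact ENat.coe_inj.mp (WithBot.coe_injective h3)
  subst hr2
  have hq : Ideal.map (algebraMap Γ(X₀, V) (X₀.presheaf.stalk η)) (Ideal.span (Set.range q)) = maximalIdeal (X₀.presheaf.stalk η) := by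
    rw [Ideal.map_span, ← hmaxη, ← hspanη]
    congr 1
    ext z; simp only [Set.mem_image, Set.mem_range]
    constructor
    · rintro ⟨_, ⟨j, rfl⟩, rfl⟩; exact ⟨j, (halgη _).symm⟩
    · rintro ⟨j, rfl⟩; exact ⟨q j, ⟨j, rfl⟩, halgη _⟩
  -- `Γ(V)/𝔭` is J-2 (quasi-excellence) …
  have hJ : IsJ2Ring (Γ(X₀, V) ⧸ 𝔭) := IsJ2Ring.of_finiteType (hqe V).2 inferInstance
  -- … and one-dimensional (the points of `C₀` other than `η` are closed)
  haveI : Ring.DimensionLEOne (Γ(X₀, V) ⧸ 𝔭) := by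
    refine ⟨fun {P} hP0 hPp => ?_⟩
    haveI := hPp
    set mk : Γ(X₀, V) →+* Γ(X₀, V) ⧸ 𝔭 := Ideal.Quotient.mk 𝔭 with hmk
    have hQp : (P.comap mk).IsPrime := Ideal.comap_isPrime mk P
    have h𝔭Q : 𝔭 ≤ P.comap mk := fun x hx => by
      rw [Ideal.mem_comap, hmk, Ideal.Quotient.eq_zero_iff_mem.mpr hx]; exact P.zero_mem
    have hPeq : P = (P.comap mk).map mk := (Ideal.map_comap_of_surjective mk Ideal.Quotient.mk_surjective P).symm
    have hQne : P.comap mk ≠ 𝔭 := by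
      intro h
      apply hP0
      rw [hPeq, h, hmk, Ideal.map_quotient_self]
    let qQ : PrimeSpectrum Γ(X₀, V) := ⟨P.comap mk, hQp⟩
    have hyV : (V.2.fromSpec qQ : X₀) ∈ (V : X₀.Opens) := fromSpec_mem V.2 qQ
    have hyq : V.2.primeIdealOf ⟨V.2.fromSpec qQ, hyV⟩ = qQ := primeIdealOf_fromSpec V.2 qQ hyV
    have hηq : V.2.fromSpec (V.2.primeIdealOf xη) = η := V.2.fromSpec_primeIdealOf xη
    have hspec : η ⤳ V.2.fromSpec qQ := by
      have h1 : V.2.primeIdealOf xη ⤳ qQ := (PrimeSpectrum.le_iff_specializes _ _).mp h𝔭Q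
      have h2 := h1.map V.2.fromSpec.continuous
      rwa [hηq] at h2
    have hyC : (V.2.fromSpec qQ : X₀) ∈ (C₀ : Set X₀) := by rw [hη]; exact specializes_iff_mem_closure.mp hspec
    have hyη : (V.2.fromSpec qQ : X₀) ≠ η := by
      intro h
      apply hQne
      have h1 : (⟨V.2.fromSpec qQ, hyV⟩ : (V : X₀.Opens)) = xη := Subtype.ext h
      have h2 : qQ = V.2.primeIdealOf xη := by rw [← hyq, h1]
      exact congrArg PrimeSpectrum.asIdeal h2
    have hQmax : (P.comap mk).IsMaximal := by
      have := V.2.primeIdealOf_isMaximal_of_isClosed ⟨V.2.fromSpec qQ, hyV⟩ (hcl _ hyC hyη)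
      rwa [hyq] at this
    rcases Ideal.map_eq_top_or_isMaximal_of_surjective mk Ideal.Quotient.mk_surjective hQmax with h | h
    · exact absurd (hPeq.trans h) hPp.ne_top
    · rwa [← hPeq] at h
  -- the ring-level theorem, with finiteness
  obtain ⟨g, F, hg𝔭, hFfin, hall⟩ := exists_not_mem_finite_forall_cleanPermissibleAt_of_cleanRegAt_generic p 𝔭 hJ (X₀.presheaf.stalk η)
    q hq hdimη G hGη
  -- `W = D(g)`
  refine ⟨X₀.basicOpen g, ?_, ?_⟩
  · rw [Scheme.mem_basicOpen _ _ _ hηV, ← halgη]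
    exact (IsLocalization.AtPrime.isUnit_to_map_iff (X₀.presheaf.stalk η) 𝔭 g).mpr hg𝔭
  -- the bad points come from the finite exceptional set of primes
  have hsub : {y : X₀ | y ∈ (C₀ : Set X₀) ∧ y ∈ X₀.basicOpen g ∧
      ¬ CleanPermissibleAt p (RatFn.toFunctionField y) G (stalkIdeal (vanishingIdeal C₀) y)} ⊆
      (fun 𝔮' : PrimeSpectrum Γ(X₀, V) => (V.2.fromSpec 𝔮' : X₀)) '' (PrimeSpectrum.asIdeal ⁻¹' F) := by
    rintro y ⟨hyC, hyW, hbad⟩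
    have hyV : y ∈ (V : X₀.Opens) := X₀.basicOpen_le g hyW
    refine ⟨V.2.primeIdealOf ⟨y, hyV⟩, ?_, V.2.fromSpec_primeIdealOf ⟨y, hyV⟩⟩
    by_contra hF𝔮
    apply hbad
    haveI : IsRegularLocalRing (X₀.presheaf.stalk y) := hX₀ y
    let xy : (V : X₀.Opens) := ⟨y, hyV⟩
    letI algy : Algebra Γ(X₀, V) (X₀.presheaf.stalk y) := TopCat.Presheaf.algebra_section_stalk X₀.presheaf xy
    haveI hlocy : IsLocalization.AtPrime (X₀.presheaf.stalk y) (V.2.primeIdealOf xy).asIdeal := V.2.isLocalization_stalk xy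
    haveI : IsScalarTower Γ(X₀, V) (X₀.presheaf.stalk y) X₀.functionField := functionField_isScalarTower X₀ (V : X₀.Opens) xy
    set 𝔮 := (V.2.primeIdealOf xy).asIdeal with h𝔮
    have halgy : ∀ f : Γ(X₀, V), algebraMap Γ(X₀, V) (X₀.presheaf.stalk y) f = (X₀.presheaf.germ V y hyV).hom f := fun f => rfl
    have hg𝔮 : g ∉ 𝔮 := by
      have h1 : IsUnit ((X₀.presheaf.germ V y hyV).hom g) := (Scheme.mem_basicOpen _ _ _ hyV).mp hyW
      rw [← halgy] at h1
      exact (IsLocalization.AtPrime.isUnit_to_map_iff (X₀.presheaf.stalk y) 𝔮 g).mp h1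
    obtain ⟨hgy, hspany⟩ := hgerm y hyV hyC
    -- `𝓘_{C₀,y} = 𝔭 𝒪_{X₀,y}`
    have hspec : η ⤳ y := by rw [specializes_iff_mem_closure, ← hη]; exact hyC
    have hC₀ : C₀ = ⟨closure {η}, isClosed_closure⟩ := Closeds.ext hη
    have hIy : stalkIdeal (vanishingIdeal C₀) y = Ideal.map (algebraMap Γ(X₀, V) (X₀.presheaf.stalk y)) 𝔭 := by
      have h1 : stalkIdeal (vanishingIdeal C₀) y = primeOfSpecializes hspec := by
        have := stalkIdeal_vanishingIdeal_closure (X := X₀) hspec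
        rwa [← hC₀] at this
      rw [h1, primeOfSpecializes_eq_map_germ hspec V hyV]
      rfl
    have hqs : Ideal.span (Set.range fun j => algebraMap Γ(X₀, V) (X₀.presheaf.stalk y) (q j)) =
        Ideal.map (algebraMap Γ(X₀, V) (X₀.presheaf.stalk y)) 𝔭 := by rw [← hIy, ← hspany]; rfl
    have hperm := hall 𝔮 hg𝔮 hF𝔮 (X₀.presheaf.stalk y) hgy hqs
    rw [hIy]; exact hperm
  refine Set.Finite.subset (Set.Finite.image _ ?_) hsub
  exact hFfin.preimage (Set.injOn_of_injective (fun a b h => PrimeSpectrum.ext h))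

/-- **Residual (a): off an open neighbourhood of its generic point, a one-dimensional irreducible closed set of a Noetherian sober space has only
finitely many points.**  `C = cl{η}`, every point of `C` other than `η` closed, `W ∋ η` open ⟹ `C ∖ W` finite (each irreducible component of the
closed Noetherian set `C ∖ W` is the closure of its generic point, a closed point). [folklore] -/
theorem finite_closure_singleton_diff_of_isOpen {α : Type*} [TopologicalSpace α] [NoetherianSpace α] [QuasiSober α] {η : α} {C : Set α}
    (hC : C = closure {η}) (hcl : ∀ y ∈ C, y ≠ η → IsClosed ({y} : Set α)) {W : Set α} (hW : IsOpen W) (hηW : η ∈ W) :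
    (C \ W).Finite := by
  have hZ : IsClosed (C \ W) := by rw [hC]; exact isClosed_closure.sdiff hW
  obtain ⟨S, hSfin, hSclosed, hSirr, hZS⟩ := NoetherianSpace.exists_finite_set_isClosed_irreducible hZ
  rw [hZS]
  refine hSfin.sUnion fun t ht => ?_
  have hirr := hSirr t ht
  set ζ := hirr.genericPoint with hζ
  have hgen : IsGenericPoint ζ t := hirr.isGenericPoint_genericPoint (hSclosed t ht)
  have hζt : ζ ∈ t := hgen.mem
  have hζZ : ζ ∈ C \ W := by rw [hZS]; exact Set.mem_sUnion_of_mem hζt ht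
  have hζη : ζ ≠ η := by rintro h; exact hζZ.2 (h ▸ hηW)
  have ht1 : t = {ζ} := by
    rw [← hgen.def, (hcl ζ hζZ.1 hζη).closure_eq]
  rw [ht1]
  exact Set.finite_singleton ζ

/-- **L7b-global, the bad set is finite.**  On a regular integral NOETHERIAN quasi-excellent `X₀` (`char K(X₀) = p`), for a one-dimensional regular
curve `C₀ = cl{η}` (`dim 𝒪_{X₀,η} = 2`, points other than `η` closed) and a line clean-regular at `η`, the points of `C₀` at which the line is NOT
clean-permissible for `C₀` form a FINITE set (✓ `exists_isOpen_finite_not_cleanPermissibleAt_of_cleanRegAt_genericPoint` inside `W`,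
✓ `finite_closure_singleton_diff_of_isOpen` outside).  These are the finitely many closed points at which L7b's point-blow-up chains
(✓ `exists_pointChain_cleanPermissibleAt_of_cleanRegAt`, p816242) are needed. [cite: CossartPiltant2008, Prop. 4.4 (proof, p. 10)]
[cite: Piltant2013, §2 Axiom 4] -/
theorem finite_setOf_not_cleanPermissibleAt_of_cleanRegAt_genericPoint {X₀ : Scheme.{0}} [IsIntegral X₀] [IsNoetherian X₀]
    (hX₀ : Scheme.IsRegular X₀) (hqe : Scheme.IsQuasiExcellent X₀) (p : ℕ) [hp : Fact p.Prime] [CharP X₀.functionField p] {C₀ : Closeds X₀}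
    (hC₀reg : ∀ y ∈ (C₀ : Set X₀), ∃ c : Fin 2 → X₀.presheaf.stalk y,
      IsRsopPart c ∧ Ideal.span (Set.range c) = stalkIdeal (vanishingIdeal C₀) y)
    {η : X₀} (hη : (C₀ : Set X₀) = closure {η}) (hdimη : ringKrullDim (X₀.presheaf.stalk η) = 2)
    (hcl : ∀ y ∈ (C₀ : Set X₀), y ≠ η → IsClosed ({y} : Set X₀))
    (G : X₀.functionField) (hGη : CleanRegAt p (RatFn.toFunctionField η) G) :
    {y : X₀ | y ∈ (C₀ : Set X₀) ∧ ¬ CleanPermissibleAt p (RatFn.toFunctionField y) G (stalkIdeal (vanishingIdeal C₀) y)}.Finite := by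
  obtain ⟨W, hηW, hfin⟩ :=
    exists_isOpen_finite_not_cleanPermissibleAt_of_cleanRegAt_genericPoint hX₀ hqe p hC₀reg hη hdimη hcl G hGη
  have hfin2 : ((C₀ : Set X₀) \ (W : Set X₀)).Finite := finite_closure_singleton_diff_of_isOpen hη hcl W.2 hηW
  refine (hfin.union hfin2).subset ?_
  rintro y ⟨hyC, hbad⟩
  by_cases hyW : y ∈ W
  · exact Or.inl ⟨hyC, hyW, hbad⟩
  · exact Or.inr ⟨hyC, hyW⟩

end Summit.ResolutionOfSingularities.ResolutionOfSingularities.Theorems.RadicialJung.CleanModels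

end
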